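import Summits.CriticalPhenomena.PercolationContinuityZ3.Theorems.Transplant.HalfSlabUniquenessExterior
import HarnessLib

/-!
# Uniqueness in half-slabs, IV: the three faces of the box and the design at a vertex

builds on p205010 (kernel theorem, internal audit signed; external expert review pending) — NOT used in this file.
Lane `prim-bschramm`, seat `prim-bschramm-p2` (gen 22; class C1b, METHOD = input substitution; memo `HOME/bschramm/P2-LATTICES.md` §68);
helper file (`--supports stmt-CriticalPhenomena-4575 --as helper`) of the HALF-SLAB UNIQUENESS programme (`HalfSlabUniquenessArms`, `…Link`,
`…Exterior`).  Setting of `HalfSlabUniquenessExterior`: a slab domain `D ⊆ S_k ∩ {x₁ ≥ 0}` containing the working region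
`{x ∈ S_k | x₁ ≥ 0, x₂ ≥ z_Ω}`, boxes `[-N, N]³` (`N ≥ k + 1`), station `Ω = (0, N+2, z_Ω)`, top `4N+8`, right end `3N+6`.

* **`move_top`** (`u₁ = N`: escape `u → u + e₁ → u + e₁ + e₂`, steep arm leaning `+e₂`), **`move_right`** (`u₂ = N`: escape `u → u + e₂`,
  leaning `+e₂`), **`move_left`** (`u₂ = -N`, `u - e₂ ∈ D`, station far left: escape `u → u - e₂`, leaning `-e₂`): on the link event of
  the escape apex, `≤ k + 2` extra open edges of `[-M, M]³` (`M = k + 7N + 14`) join `u` to `Ω` through open EXTERIOR steps of `D`;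
* **`vertex_design`**: for every inner-boundary vertex `u` of `[-N, N]³` an increasing event, measurable, determined by the edges of
  `[-M, M]³`, of probability `≥ α²` (arm kit), carrying that move — the per-vertex input of the Aizenman–Chayes–Chayes–Fröhlich–Russo
  criterion.
[cite: AizenmanChayesChayesFrohlichRusso1983, §4 Cor. to Lemma 4.3, Lemma 4.2 (a)] [cite: BarskyGrimmettNewman1991, Comment 6 p. 116, Cor. (iii)] -/

noncomputable section

namespace Summit.CriticalPhenomena.PercolationContinuityZ3.Theorems.Transplant

namespace HalfSlabUniq

open MeasureTheory Literature.Probability.Percolation Literature.Probability.LatticeModels SimpleGraph HSU OrthantUniq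
open scoped Classical

variable {k : ℕ} {D : Set (Site 3)} {N : ℕ}

section Design

variable {zΩ : ℤ} (hD : D ⊆ slab 3 k) (hD1 : ∀ x ∈ D, 0 ≤ x 1) (hW : ∀ x ∈ slab 3 k, 0 ≤ x 1 → zΩ ≤ x 2 → x ∈ D)
  (hz0 : zΩ ≤ 0) (hzlo : -(3 * (N : ℤ) + 6) ≤ zΩ)

include hD hW hz0 hzlo in
/-- **Top face** `u₁ = N`: escape `u → u + e₁ → u + e₁ + e₂`, steep arm leaning `+e₂` from `b = u + e₁ + e₂`; `≤ k + 2` sprinkled edges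
join `u` to the station (given `z_Ω ≤ u₂`). [cite: AizenmanChayesChayesFrohlichRusso1983, §4 Lemma 4.3, Lemma 4.2 (a)] -/
theorem move_top {u : Site 3} (huD : u ∈ D) (hubox : u ∈ boxSet 3 N) (hu1 : u 1 = N) (hzu : zΩ ≤ u 2) {ω : BondConfig (Site 3)}
    (hω : ω ∈ linkEvent k 1 (u + Pi.single 1 1 + Pi.single 2 1) ![0, (N : ℤ) + 2, zΩ] (4 * (N : ℤ) + 8) (3 * (N : ℤ) + 6)) :
    ∃ F : Finset (Sym2 (Site 3)), F ⊆ edgesIn (zdGraph 3) (box 3 (k + 7 * N + 14)) ∧ F.card ≤ k + 2 ∧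
      ω ∪ ↑F ∈ openConnVia (starGraph (withinGraph (zdGraph 3) D) Set.univ (boxSet 3 N)) u ![0, (N : ℤ) + 2, zΩ] := by
  set m : Site 3 := u + Pi.single 1 1 with hm_def
  set b : Site 3 := m + Pi.single 2 1 with hb_def
  have hm0 : m 0 = u 0 := by simp [hm_def]
  have hm1 : m 1 = u 1 + 1 := by simp [hm_def]
  have hm2 : m 2 = u 2 := by simp [hm_def]
  have hb0 : b 0 = u 0 := by simp [hb_def, hm0]
  have hb1 : b 1 = u 1 + 1 := by simp [hb_def, hm1]
  have hb2 : b 2 = u 2 + 1 := by simp [hb_def, hm2]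
  have hu0 : 0 ≤ u 0 ∧ u 0 ≤ (k : ℤ) := hD huD
  have hu2 := (mem_boxSet_iff.1 hubox) 2
  have hmslab : m ∈ slab 3 k := by show 0 ≤ m 0 ∧ m 0 ≤ (k : ℤ); rw [hm0]; exact hu0
  have hbslab : b ∈ slab 3 k := by show 0 ≤ b 0 ∧ b 0 ≤ (k : ℤ); rw [hb0]; exact hu0
  have hmD : m ∈ D := hW m hmslab (by omega) (by omega)
  have hbD : b ∈ D := hW b hbslab (by omega) (by omega)
  have hS : ∀ x ∈ steepReg k 1 b (4 * (N : ℤ) + 8), x ∉ boxSet 3 N ∧ zΩ ≤ x 2 ∧ x 2 ≤ 3 * (N : ℤ) + 6 := by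
    intro x hx
    obtain ⟨-, h1, hT, h3, h4, -⟩ := steepReg_props (Or.inl rfl : (1 : ℤ) = 1 ∨ (1 : ℤ) = -1) hx
    rw [hb1, hu1] at h1 h4; rw [hb2] at h3 h4
    exact ⟨not_mem_boxSet_of_lt (j := 1) (by rw [abs_of_nonneg (by omega)]; omega), by omega, by omega⟩
  obtain ⟨F, hFs, hFc, hFr⟩ := move_apex hW hz0 hzlo (Or.inl rfl) hbslab (by omega) (by omega)
    (by rw [hb2, abs_le]; constructor <;> omega) hS hω
  have hadj1 : (zdGraph 3).Adj u m := (zdGraph_adj_iff _ _).2 ⟨1, Or.inl rfl⟩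
  have hadj2 : (zdGraph 3).Adj m b := (zdGraph_adj_iff _ _).2 ⟨2, Or.inl rfl⟩
  have hmbox : m ∉ boxSet 3 N := not_mem_boxSet_of_lt (j := 1) (by rw [hm1, abs_of_nonneg (by omega)]; omega)
  have hK1 : (starGraph (withinGraph (zdGraph 3) D) Set.univ (boxSet 3 N)).Adj u m := dext_adj_of hadj1 huD hmD fun h => hmbox h.2
  have hK2 : (starGraph (withinGraph (zdGraph 3) D) Set.univ (boxSet 3 N)).Adj m b := dext_adj_of hadj2 hmD hbD fun h => hmbox h.1
  have hwu : ∀ j, |u j| ≤ (k + 7 * N + 14 : ℕ) := abs_le_of_mem_boxSet hubox (by omega)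
  have hwm : ∀ j, |m j| ≤ (k + 7 * N + 14 : ℕ) := abs_le_of_mem_boxSet (add_single_mem_boxSet hubox 1) (by omega)
  have hwb : ∀ j, |b j| ≤ (k + 7 * N + 14 : ℕ) :=
    abs_le_of_mem_boxSet (add_single_mem_boxSet (add_single_mem_boxSet hubox 1) 2) (by omega)
  refine ⟨insert s(u, m) (insert s(m, b) F), ?_, ?_, ?_⟩
  · intro e he
    rcases Finset.mem_insert.1 he with rfl | he
    · exact mem_edgesIn_of_adj hadj1 hwu hwm
    rcases Finset.mem_insert.1 he with rfl | he
    · exact mem_edgesIn_of_adj hadj2 hwm hwb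
    · exact hFs he
  · have hc1 := Finset.card_insert_le s(m, b) F
    have hc2 := Finset.card_insert_le s(u, m) (insert s(m, b) F)
    omega
  · exact openConnVia_step hK1 (Finset.mem_insert_self _ _)
      (openConnVia_step hK2 (Finset.mem_insert_of_mem (Finset.mem_insert_self _ _))
        (openConnVia_mono_finset (fun e he => Finset.mem_insert_of_mem (Finset.mem_insert_of_mem he)) hFr))

include hD hD1 hW hz0 hzlo in
/-- **Right face** `u₂ = N`: escape `u → u + e₂`, steep arm leaning `+e₂` from `b = u + e₂`; `≤ k + 1` sprinkled edges join `u` to the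
station. [cite: AizenmanChayesChayesFrohlichRusso1983, §4 Lemma 4.3, Lemma 4.2 (a)] -/
theorem move_right {u : Site 3} (huD : u ∈ D) (hubox : u ∈ boxSet 3 N) (hu2 : u 2 = N) {ω : BondConfig (Site 3)}
    (hω : ω ∈ linkEvent k 1 (u + Pi.single 2 1) ![0, (N : ℤ) + 2, zΩ] (4 * (N : ℤ) + 8) (3 * (N : ℤ) + 6)) :
    ∃ F : Finset (Sym2 (Site 3)), F ⊆ edgesIn (zdGraph 3) (box 3 (k + 7 * N + 14)) ∧ F.card ≤ k + 2 ∧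
      ω ∪ ↑F ∈ openConnVia (starGraph (withinGraph (zdGraph 3) D) Set.univ (boxSet 3 N)) u ![0, (N : ℤ) + 2, zΩ] := by
  set b : Site 3 := u + Pi.single 2 1 with hb_def
  have hb0 : b 0 = u 0 := by simp [hb_def]
  have hb1 : b 1 = u 1 := by simp [hb_def]
  have hb2 : b 2 = u 2 + 1 := by simp [hb_def]
  have hu0 : 0 ≤ u 0 ∧ u 0 ≤ (k : ℤ) := hD huD
  have hu1 := hD1 u huD
  have hu1' := (mem_boxSet_iff.1 hubox) 1
  have hbslab : b ∈ slab 3 k := by show 0 ≤ b 0 ∧ b 0 ≤ (k : ℤ); rw [hb0]; exact hu0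
  have hbD : b ∈ D := hW b hbslab (by omega) (by omega)
  have hS : ∀ x ∈ steepReg k 1 b (4 * (N : ℤ) + 8), x ∉ boxSet 3 N ∧ zΩ ≤ x 2 ∧ x 2 ≤ 3 * (N : ℤ) + 6 := by
    intro x hx
    obtain ⟨-, h1, hT, h3, h4, -⟩ := steepReg_props (Or.inl rfl : (1 : ℤ) = 1 ∨ (1 : ℤ) = -1) hx
    rw [hb1] at h1 h4; rw [hb2, hu2] at h3 h4
    exact ⟨not_mem_boxSet_of_lt (j := 2) (by rw [abs_of_nonneg (by omega)]; omega), by omega, by omega⟩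
  obtain ⟨F, hFs, hFc, hFr⟩ := move_apex hW hz0 hzlo (Or.inl rfl) hbslab (by omega) (by omega)
    (by rw [hb2, abs_le]; constructor <;> omega) hS hω
  have hadj : (zdGraph 3).Adj u b := (zdGraph_adj_iff _ _).2 ⟨2, Or.inl rfl⟩
  have hbbox : b ∉ boxSet 3 N := not_mem_boxSet_of_lt (j := 2) (by rw [hb2, abs_of_nonneg (by omega)]; omega)
  have hK : (starGraph (withinGraph (zdGraph 3) D) Set.univ (boxSet 3 N)).Adj u b := dext_adj_of hadj huD hbD fun h => hbbox h.2
  have hwu : ∀ j, |u j| ≤ (k + 7 * N + 14 : ℕ) := abs_le_of_mem_boxSet hubox (by omega)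
  have hwb : ∀ j, |b j| ≤ (k + 7 * N + 14 : ℕ) := abs_le_of_mem_boxSet (add_single_mem_boxSet hubox 2) (by omega)
  refine ⟨insert s(u, b) F, ?_, (Finset.card_insert_le _ _).trans (by omega), ?_⟩
  · intro e he
    rcases Finset.mem_insert.1 he with rfl | he
    · exact mem_edgesIn_of_adj hadj hwu hwb
    · exact hFs he
  · exact openConnVia_step hK (Finset.mem_insert_self _ _) (openConnVia_mono_finset (fun e he => Finset.mem_insert_of_mem he) hFr)

include hD hD1 hW hz0 hzlo in
/-- **Left face** `u₂ = -N` with `u - e₂ ∈ D` (then the station is far left: `z_Ω ≤ -(3N+6)`): escape `u → u - e₂`, steep arm leaning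
`-e₂` from `b = u - e₂`; `≤ k + 1` sprinkled edges join `u` to the station. [cite: AizenmanChayesChayesFrohlichRusso1983, §4 Lemma 4.3, Lemma 4.2 (a)] -/
theorem move_left {u : Site 3} (huD : u ∈ D) (hubox : u ∈ boxSet 3 N) (hu2 : u 2 = -(N : ℤ)) (hbD : u - Pi.single 2 1 ∈ D)
    (hfar : zΩ ≤ -(3 * (N : ℤ) + 6)) {ω : BondConfig (Site 3)}
    (hω : ω ∈ linkEvent k (-1) (u - Pi.single 2 1) ![0, (N : ℤ) + 2, zΩ] (4 * (N : ℤ) + 8) (3 * (N : ℤ) + 6)) :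
    ∃ F : Finset (Sym2 (Site 3)), F ⊆ edgesIn (zdGraph 3) (box 3 (k + 7 * N + 14)) ∧ F.card ≤ k + 2 ∧
      ω ∪ ↑F ∈ openConnVia (starGraph (withinGraph (zdGraph 3) D) Set.univ (boxSet 3 N)) u ![0, (N : ℤ) + 2, zΩ] := by
  set b : Site 3 := u - Pi.single 2 1 with hb_def
  have hb0 : b 0 = u 0 := by simp [hb_def]
  have hb1 : b 1 = u 1 := by simp [hb_def]
  have hb2 : b 2 = u 2 - 1 := by simp [hb_def]
  have hu0 : 0 ≤ u 0 ∧ u 0 ≤ (k : ℤ) := hD huD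
  have hu1 := hD1 u huD
  have hu1' := (mem_boxSet_iff.1 hubox) 1
  have hbslab : b ∈ slab 3 k := by show 0 ≤ b 0 ∧ b 0 ≤ (k : ℤ); rw [hb0]; exact hu0
  have hS : ∀ x ∈ steepReg k (-1) b (4 * (N : ℤ) + 8), x ∉ boxSet 3 N ∧ zΩ ≤ x 2 ∧ x 2 ≤ 3 * (N : ℤ) + 6 := by
    intro x hx
    obtain ⟨-, h1, hT, h3, h4, -⟩ := steepReg_props (Or.inr rfl : (-1 : ℤ) = 1 ∨ (-1 : ℤ) = -1) hx
    rw [hb1] at h1 h4; rw [hb2, hu2] at h3 h4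
    exact ⟨not_mem_boxSet_of_lt (j := 2) (by rw [abs_of_nonpos (by omega)]; omega), by omega, by omega⟩
  obtain ⟨F, hFs, hFc, hFr⟩ := move_apex hW hz0 hzlo (Or.inr rfl) hbslab (by omega) (by omega)
    (by rw [hb2, abs_le]; constructor <;> omega) hS hω
  have hadj : (zdGraph 3).Adj u b := (zdGraph_adj_iff _ _).2 ⟨2, Or.inr (by rw [hb_def, sub_add_cancel])⟩
  have hbbox : b ∉ boxSet 3 N := not_mem_boxSet_of_lt (j := 2) (by rw [hb2, abs_of_nonpos (by omega)]; omega)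
  have hK : (starGraph (withinGraph (zdGraph 3) D) Set.univ (boxSet 3 N)).Adj u b := dext_adj_of hadj huD hbD fun h => hbbox h.2
  have hwu : ∀ j, |u j| ≤ (k + 7 * N + 14 : ℕ) := abs_le_of_mem_boxSet hubox (by omega)
  have hwb : ∀ j, |b j| ≤ (k + 7 * N + 14 : ℕ) := abs_le_of_mem_boxSet (sub_single_mem_boxSet hubox 2) (by omega)
  refine ⟨insert s(u, b) F, ?_, (Finset.card_insert_le _ _).trans (by omega), ?_⟩
  · intro e he
    rcases Finset.mem_insert.1 he with rfl | he
    · exact mem_edgesIn_of_adj hadj hwu hwb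
    · exact hFs he
  · exact openConnVia_step hK (Finset.mem_insert_self _ _) (openConnVia_mono_finset (fun e he => Finset.mem_insert_of_mem he) hFr)

/-- **The design at a vertex.** Let `D ⊆ S_k ∩ {x₁ ≥ 0}` contain the working region `{x ∈ S_k | x₁ ≥ 0, x₂ ≥ z_Ω}` with
`-(3N+6) ≤ z_Ω ≤ 0`, `z_Ω ≤ u₂` on `D ∩ [-N,N]³`, and the station far left if `D` has a left-face vertex; `N ≥ k + 1`; `A` an arm kit at
`p'`.  For every inner-boundary vertex `u` of `[-N,N]³` there is an increasing measurable event `E`, determined by the edges of `[-M,M]³`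
(`M = k + 7N + 14`), with `P_{p'}(E) ≥ α²`, on which `≤ k + 2` extra open edges of `[-M,M]³` join `u` to the station `Ω = (0, N+2, z_Ω)`
through open exterior steps. [cite: AizenmanChayesChayesFrohlichRusso1983, §4 Cor. to Lemma 4.3 and Lemma 4.2 (a)] -/
theorem vertex_design (hD : D ⊆ slab 3 k) (hD1 : ∀ x ∈ D, 0 ≤ x 1) (hW : ∀ x ∈ slab 3 k, 0 ≤ x 1 → zΩ ≤ x 2 → x ∈ D)
    (hz0 : zΩ ≤ 0) (hzlo : -(3 * (N : ℤ) + 6) ≤ zΩ) (hzbox : ∀ u ∈ D, u ∈ boxSet 3 N → zΩ ≤ u 2)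
    (hleft : ∀ u ∈ D, u - Pi.single 2 1 ∈ D → u 2 = -(N : ℤ) → zΩ ≤ -(3 * (N : ℤ) + 6)) (hN : k + 1 ≤ N)
    {p' : unitInterval} (A : SlabArmKit k p') {u : Site 3} (hu : u ∈ boxSet 3 N)
    (hw : ∃ w, w ∉ boxSet 3 N ∧ (withinGraph (zdGraph 3) D).Adj u w) :
    ∃ E : Set (BondConfig (Site 3)), IsUpperSet E ∧ MeasurableSet E ∧ DeterminedBy E ↑(edgesIn (zdGraph 3) (box 3 (k + 7 * N + 14))) ∧
      A.α ^ 2 ≤ (bondPercolation (zdGraph 3) p').real E ∧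
      ∀ ω ∈ E, ∃ F : Finset (Sym2 (Site 3)), F ⊆ edgesIn (zdGraph 3) (box 3 (k + 7 * N + 14)) ∧ F.card ≤ k + 2 ∧
        ω ∪ ↑F ∈ openConnVia (starGraph (withinGraph (zdGraph 3) D) Set.univ (boxSet 3 N)) u ![0, (N : ℤ) + 2, zΩ] := by
  obtain ⟨huD, hface⟩ := innerBdry_cases hD hD1 hN hu hw
  have hu0 : 0 ≤ u 0 ∧ u 0 ≤ (k : ℤ) := hD huD
  have hu1 := (mem_boxSet_iff.1 hu) 1
  have hu2 := (mem_boxSet_iff.1 hu) 2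
  have hu1D := hD1 u huD
  obtain ⟨-, -, e2⟩ := station_coords N zΩ
  have hΩ : (![0, (N : ℤ) + 2, zΩ] : Site 3) ∈ slab 3 k := station_mem_slab N zΩ
  -- generic packaging of a link event
  have pack : ∀ {σ : ℤ} (_ : σ = 1 ∨ σ = -1) {b : Site 3} (_ : b ∈ slab 3 k) (_ : 0 ≤ b 1) (_ : b 1 ≤ (N : ℤ) + 1)
      (_ : |b 2| ≤ (N : ℤ) + 1)
      (_ : ∀ ω ∈ linkEvent k σ b ![0, (N : ℤ) + 2, zΩ] (4 * (N : ℤ) + 8) (3 * (N : ℤ) + 6),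
        ∃ F : Finset (Sym2 (Site 3)), F ⊆ edgesIn (zdGraph 3) (box 3 (k + 7 * N + 14)) ∧ F.card ≤ k + 2 ∧
          ω ∪ ↑F ∈ openConnVia (starGraph (withinGraph (zdGraph 3) D) Set.univ (boxSet 3 N)) u ![0, (N : ℤ) + 2, zΩ]),
      ∃ E : Set (BondConfig (Site 3)), IsUpperSet E ∧ MeasurableSet E ∧
        DeterminedBy E ↑(edgesIn (zdGraph 3) (box 3 (k + 7 * N + 14))) ∧ A.α ^ 2 ≤ (bondPercolation (zdGraph 3) p').real E ∧
        ∀ ω ∈ E, ∃ F : Finset (Sym2 (Site 3)), F ⊆ edgesIn (zdGraph 3) (box 3 (k + 7 * N + 14)) ∧ F.card ≤ k + 2 ∧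
          ω ∪ ↑F ∈ openConnVia (starGraph (withinGraph (zdGraph 3) D) Set.univ (boxSet 3 N)) u ![0, (N : ℤ) + 2, zΩ] := by
    intro σ hσ b hb hb1 hb1' hb2 hmove
    refine ⟨_, linkEvent_upper, linkEvent_measurable, linkEvent_determinedBy fun x hx => ?_,
      link_prob A hσ hb hΩ (by omega) (by rw [e2]; omega), hmove⟩
    rcases hx with hx | hx
    · exact steepReg_apex_window hσ hb1 hb1' hb2 hx
    · exact shallowReg_station_window hz0 hzlo hx
  rcases hface with htop | hright | ⟨hleft2, hbD⟩
  · -- top face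
    have e0 : (u + Pi.single 1 1 + Pi.single 2 1 : Site 3) 0 = u 0 := by simp
    have e1 : (u + Pi.single 1 1 + Pi.single 2 1 : Site 3) 1 = u 1 + 1 := by simp
    have e2' : (u + Pi.single 1 1 + Pi.single 2 1 : Site 3) 2 = u 2 + 1 := by simp
    have hb : (u + Pi.single 1 1 + Pi.single 2 1 : Site 3) ∈ slab 3 k := by
      show (0 : ℤ) ≤ (u + Pi.single 1 1 + Pi.single 2 1 : Site 3) 0 ∧ (u + Pi.single 1 1 + Pi.single 2 1 : Site 3) 0 ≤ (k : ℤ)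
      rw [e0]; exact hu0
    exact pack (Or.inl rfl) hb (by rw [e1]; omega) (by rw [e1]; omega) (by rw [e2', abs_le]; constructor <;> omega)
      fun ω hω => move_top hD hW hz0 hzlo huD hu htop (hzbox u huD hu) hω
  · -- right face
    have e0 : (u + Pi.single 2 1 : Site 3) 0 = u 0 := by simp
    have e1 : (u + Pi.single 2 1 : Site 3) 1 = u 1 := by simp
    have e2' : (u + Pi.single 2 1 : Site 3) 2 = u 2 + 1 := by simp
    have hb : (u + Pi.single 2 1 : Site 3) ∈ slab 3 k := by
      show (0 : ℤ) ≤ (u + Pi.single 2 1 : Site 3) 0 ∧ (u + Pi.single 2 1 : Site 3) 0 ≤ (k : ℤ)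
      rw [e0]; exact hu0
    exact pack (Or.inl rfl) hb (by rw [e1]; omega) (by rw [e1]; omega) (by rw [e2', abs_le]; constructor <;> omega)
      fun ω hω => move_right hD hD1 hW hz0 hzlo huD hu hright hω
  · -- left face
    have e0 : (u - Pi.single 2 1 : Site 3) 0 = u 0 := by simp
    have e1 : (u - Pi.single 2 1 : Site 3) 1 = u 1 := by simp
    have e2' : (u - Pi.single 2 1 : Site 3) 2 = u 2 - 1 := by simp
    have hb : (u - Pi.single 2 1 : Site 3) ∈ slab 3 k := by
      show (0 : ℤ) ≤ (u - Pi.single 2 1 : Site 3) 0 ∧ (u - Pi.single 2 1 : Site 3) 0 ≤ (k : ℤ)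
      rw [e0]; exact hu0
    exact pack (Or.inr rfl) hb (by rw [e1]; omega) (by rw [e1]; omega) (by rw [e2', abs_le]; constructor <;> omega)
      fun ω hω => move_left hD hD1 hW hz0 hzlo huD hu hleft2 hbD (hleft u huD hbD hleft2) hω

end Design

end HalfSlabUniq

end Summit.CriticalPhenomena.PercolationContinuityZ3.Theorems.Transplant

end
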